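import Mathlib
import HarnessLib

/-!
# Barrier: the «exact linear representation» of a nonlinear evolution (Koopman / Lie-series
# embedding `A = ∫ F(u) δ/δu`) has an UNBOUNDED derivation as generator — its exponential series
# is the time-Taylor (Lie) series of the nonlinear flow, with finite radius — and dissipativity at
# the one vector `u` is not dissipativity of `A`

Catalogue entry (kind (c), method-level lemma; cell ns-claims, D-0090; technique row «abstract-operator
family: linear-operator / semigroup re-encoding of the nonlinear problem»), salvage seat
ns-claims-salvage-p1. Everything below is PROVED (no named fact).

THE DEVICE. Fix a vector field `F` (an ODE `ż = ϑ(z)`, or a PDE `∂ₜu = F(u, ∂u, …)`). On functionals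
(«observables») `G` of the state define the first-order operator `A G = G'(·)[F]` — for an ODE the Lie
derivative `D = Σ ϑⱼ(z) ∂/∂zⱼ` [cite: HairerWannerLubich2002, §III.5.1 eq. (5.3)–(5.4)], for a field
theory `A = ∫ dζ F(u(ζ)) δ/δu(ζ)` [cite: Kosovtsov2022, (8) p.3]. `A` is LINEAR in `G`, and formally
`∂ₜ G(u(t)) = (A G)(u(t))`: the nonlinear problem «becomes» the linear evolution `Ġ = A G`, to which one
is tempted to apply the theory of operator semigroups (`T(t) = e^{tA}`, Hille–Yosida, Lumer–Phillips).

WHY IT CARRIES NO REGULARITY INFORMATION (three kernel facts).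

1. **`e^{tA}` as a power series is the Lie series = the Taylor series in `t` of `G ∘ Φ_t`.** By the chain
   rule `dᵏ/dtᵏ G(Φ_t z) = (Dᵏ G)(Φ_t z)`, so `Σₖ tᵏ (DᵏG)(z)/k! ` is the Taylor series of `t ↦ G(Φ_t z)`
   at `t = 0` [cite: HairerWannerLubich2002, §III.5.1 eq. (5.7)–(5.8) and Lemma 5.1 (Gröbner 1960)]
   (Gröbner's Lie series; convergence only for small `|t|` in the analytic class
   [cite: Grobner1967LieReihen, Kap. I §2–§3]). It converges exactly as far as the nonlinear flow is
   time-analytic — no further. KERNEL WITNESS (`lieIter_sq_id`, `hasSum_lieSeries`,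
   `not_summable_lieSeries`): for `ż = z²` and the observable `G = id`, `Dᵏ id = k! z^{k+1}`, the series is
   `Σ z (tz)ᵏ`, with radius `1/|z|` = the blow-up time of `z/(1 − tz)` (`flow_hasDerivAt`,
   `flow_unbounded`); for every `t > 0` it diverges at `z = 1/t`. So «`T(t) = exp{tA} = Σ tⁿAⁿ/n!`, where
   the power series converges for every `t ≥ 0`» [cite: Kosovtsov2022, p.5 l.1–4 after (12); p.8–9 around (22)]
   is false for the simplest nonlinear `F`; the cited source states that formula for BOUNDED generators
   only (uniformly continuous semigroups) [cite: EngelNagel2006, Thm I.2.12] and warns that for unbounded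
   `A` the series may converge «only for t = 0 or x = 0» [cite: EngelNagel2006, §II.3 eq. (3.1) Comment].
   For `F ∋ Δ` already the LINEAR part has finite time-Taylor radius at a Gaussian (tree barrier
   `Literature.Barriers.NavierStokesRegularity.not_exists_entire_timeSeries`, `TimeTaylorFiniteRadius`).
2. **`A` is a derivation containing `∂`: it is not bounded** on any space of observables containing the
   local ones — «A is continuous and therefore it is bounded and closable» [cite: Kosovtsov2022, §2 p.4 l.1–2; §3 p.7 l.9–11]
   is the sentence the cell's refuter lane tests at step level (claim C33,
   `Literature.Claims.NS.Kosovtsov2022.Step_2` / `Step_3`, over the paper's own space `L²_u`). Item 1 is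
   the quantitative form: a bounded `A` would give an entire exponential series.
3. **Dissipativity is a statement about ALL of `D(A)`, not about the one vector `u`.** Lumer–Phillips
   needs `⟪Aw, w⟫ ≤ 0` for every `w ∈ D(A)` [cite: EngelNagel2006, Thm II.3.15]; the energy identity
   `⟪Au, u⟫ = −ν‖∇u‖² ≤ 0` [cite: Kosovtsov2022, (21) p.8] is the single instance `w = u` (the coordinate
   observables), and «Hence, the linear operator A … is dissipative» / «so adjoint operator A* is
   dissipative too» [cite: Kosovtsov2022, p.8 l.7–13] does not follow. KERNEL WITNESS
   (`OneVector.*`): the symmetric `2 × 2` matrix `A = diag(−1, 1)` has `⟪Ae₁, e₁⟫ = −1 ≤ 0` (and `A* = A`),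
   yet `⟪Ae₂, e₂⟫ = 1 > 0` and the orbit `e^{tA}e₂ = eᵗ e₂` grows: no contraction semigroup.

Cell record: instance under adjudication = claim C33 `Kosovtsov2022` (arXiv:2209.06587 v3), typed
skeleton `Literature.Claims.NS.Kosovtsov2022` (p471651). This entry is the METHOD-level statement behind
the step-level tests (`BoundedOn` / `DissipOn` over the linear local sub-family of `L²_u`); it is
independent of, and does not pre-empt, the cell's verdict of record (first failing step and class are
posted on the MAP `pub/ns-claims/WHERE-PROOFS-BREAK.md`, not here).

BARRIER (structured block, D-0021): see `KoopmanLieSeriesFiniteRadius` below.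

WHAT THIS IS NOT: not a claim about NS regularity or blow-up; not a claim about any author beyond the
typed locator.
-/

noncomputable section

open Real Filter Topology Matrix

namespace Literature.Barriers.NavierStokesRegularity

namespace KoopmanLieSeriesFiniteRadius

/-! ## The Lie derivative of a scalar ODE and its iterates -/

/-- The Lie derivative (Koopman generator) of the scalar ODE `ż = ϑ(z)` acting on an observable `g`:
`(D_ϑ g)(z) = ϑ(z) g'(z)`. [cite: HairerWannerLubich2002, §III.5.1 eq. (5.3)–(5.4)] -/
def lieD (ϑ g : ℝ → ℝ) : ℝ → ℝ := fun z => ϑ z * deriv g z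

/-- The iterated Lie derivative `D_ϑᵏ g`. [cite: HairerWannerLubich2002, §III.5.1 eq. (5.6)] -/
def lieIter (ϑ : ℝ → ℝ) (k : ℕ) (g : ℝ → ℝ) : ℝ → ℝ := (lieD ϑ)^[k] g

/-- The quadratic vector field `ϑ(z) = z²` (the `x`-independent caricature of `u·∇u`). [folklore] -/
def sq : ℝ → ℝ := fun z => z ^ 2

/-- `D^{k+1} g = D (Dᵏ g)`. [cite: HairerWannerLubich2002, §III.5.1 eq. (5.6)] -/
theorem lieIter_succ (ϑ : ℝ → ℝ) (k : ℕ) (g : ℝ → ℝ) :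
    lieIter ϑ (k + 1) g = lieD ϑ (lieIter ϑ k g) :=
  Function.iterate_succ_apply' (lieD ϑ) k g

/-- **The Lie iterates of the identity under `z² d/dz`: `Dᵏ id (z) = k! · z^{k+1}`.**
[cite: Grobner1967LieReihen, Kap. I §2] -/
theorem lieIter_sq_id (k : ℕ) : lieIter sq k id = fun z => (k.factorial : ℝ) * z ^ (k + 1) := by
  induction k with
  | zero =>
    funext z
    simp [lieIter]
  | succ k ih =>
    rw [lieIter_succ, ih]
    funext z
    unfold lieD sq
    have hd : deriv (fun w : ℝ => (k.factorial : ℝ) * w ^ (k + 1)) z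
        = (k.factorial : ℝ) * ((k + 1 : ℕ) * z ^ k) := by
      rw [deriv_const_mul _ (differentiableAt_pow (k + 1)), deriv_pow_field]
      simp
    rw [hd, Nat.factorial_succ]
    push_cast
    ring

/-- **The `k`-th term of the exponential series `Σ tᵏ Aᵏ/k!` on the observable `id` is `z (tz)ᵏ`.**
[cite: HairerWannerLubich2002, §III.5.1 eq. (5.8)] -/
theorem lieSeries_term (k : ℕ) (t z : ℝ) :
    t ^ k * lieIter sq k id z / k.factorial = z * (t * z) ^ k := by
  rw [lieIter_sq_id]
  have hk : (k.factorial : ℝ) ≠ 0 := by exact_mod_cast k.factorial_ne_zero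
  field_simp
  ring

/-- **Convergence inside the radius: the Lie series sums to the flow.** For `|tz| < 1`,
`Σₖ tᵏ (Dᵏ id)(z)/k! = z/(1 − tz)` — Gröbner's theorem `e^{tD} id (z) = Φ_t(z)` for `ż = z²`
(`Φ_t(z) = z/(1 − tz)`), valid for SMALL `|t|` only. [cite: Grobner1967LieReihen, Kap. I §2–§3]
[cite: HairerWannerLubich2002, §III.5.1 eq. (5.8)] -/
theorem hasSum_lieSeries {t z : ℝ} (h : |t * z| < 1) :
    HasSum (fun k : ℕ => t ^ k * lieIter sq k id z / k.factorial) (z / (1 - t * z)) := by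
  simp_rw [lieSeries_term]
  rw [div_eq_mul_inv]
  exact (hasSum_geometric_of_abs_lt_one h).mul_left z

/-- **Divergence at and beyond the radius**: for `z ≠ 0` and `|tz| ≥ 1` the exponential series on `id`
does not converge (its terms have modulus `≥ |z|`). [cite: Grobner1967LieReihen, Kap. I §2] -/
theorem not_summable_lieSeries {t z : ℝ} (hz : z ≠ 0) (h : 1 ≤ |t * z|) :
    ¬ Summable (fun k : ℕ => t ^ k * lieIter sq k id z / k.factorial) := by
  simp_rw [lieSeries_term]
  intro hs
  have h0 := hs.tendsto_atTop_zero
  rw [Metric.tendsto_atTop] at h0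
  obtain ⟨N, hN⟩ := h0 |z| (abs_pos.2 hz)
  have hNN := hN N le_rfl
  rw [dist_zero_right, norm_mul, norm_pow, Real.norm_eq_abs, Real.norm_eq_abs] at hNN
  have h1 : (1 : ℝ) ≤ |t * z| ^ N := one_le_pow₀ h
  have h2 : |z| * 1 ≤ |z| * |t * z| ^ N := mul_le_mul_of_nonneg_left h1 (abs_nonneg z)
  linarith

/-- **For every `t > 0` the exponential series diverges at some point** (`z = 1/t`): there is no
`t > 0` for which «`Σ tⁿAⁿ/n!` converges» on the observable `id`, let alone «for every `t ≥ 0`».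
[cite: EngelNagel2006, §II.3 eq. (3.1) Comment] -/
theorem exists_not_summable_lieSeries {t : ℝ} (ht : 0 < t) :
    ∃ z : ℝ, ¬ Summable (fun k : ℕ => t ^ k * lieIter sq k id z / k.factorial) := by
  refine ⟨t⁻¹, not_summable_lieSeries (inv_ne_zero ht.ne') ?_⟩
  rw [mul_inv_cancel₀ ht.ne', abs_one]

/-- **The sum IS the nonlinear flow**: `t ↦ z/(1 − tz)` solves `ẏ = y²` wherever `1 − tz ≠ 0`
(so the linear series knows exactly what the nonlinear solution knows, and nothing more).
[cite: HairerWannerLubich2002, §III.5.1 eq. (5.5)] -/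
theorem flow_hasDerivAt {t z : ℝ} (h : 1 - t * z ≠ 0) :
    HasDerivAt (fun s : ℝ => z / (1 - s * z)) ((z / (1 - t * z)) ^ 2) t := by
  have h1 : HasDerivAt (fun s : ℝ => 1 - s * z) (-z) t := by
    simpa using ((hasDerivAt_id t).mul_const z).const_sub 1
  have h2 : HasDerivAt (fun s : ℝ => z / (1 - s * z))
      ((0 * (1 - t * z) - z * -z) / (1 - t * z) ^ 2) t := (hasDerivAt_const t z).div h1 h
  refine h2.congr_deriv ?_
  rw [div_pow]
  ring

/-- **The radius is the blow-up time**: for `z > 0` the flow `z/(1 − tz)` takes the value `k z` at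
`t = (1 − 1/k)/z < 1/z` — unbounded as `t ↑ 1/z`, the radius of the Lie series. The linear embedding
does not remove the singularity of the nonlinear problem; it reproduces it. [cite: Grobner1967LieReihen, Kap. I §3] -/
theorem flow_unbounded {z : ℝ} (hz : 0 < z) (k : ℝ) :
    z / (1 - ((1 - k⁻¹) / z) * z) = k * z := by
  have hz' : z ≠ 0 := hz.ne'
  have h1 : (1 - k⁻¹) / z * z = 1 - k⁻¹ := div_mul_cancel₀ _ hz'
  rw [h1, show (1 : ℝ) - (1 - k⁻¹) = k⁻¹ by ring, div_inv_eq_mul, mul_comm]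

end KoopmanLieSeriesFiniteRadius

/-! ## One-vector «dissipativity» versus dissipativity -/

namespace KoopmanLieSeriesFiniteRadius.OneVector

/-- The symmetric matrix `A = diag(−1, 1)` on `ℝ²`. [folklore] -/
def A : Matrix (Fin 2) (Fin 2) ℝ := !![-1, 0; 0, 1]

/-- `A` is symmetric (`A* = A`): the adjoint sentence «⟨u, A*u⟩ = ⟨Au, u⟩ ≤ 0, so A* is dissipative
too» is the same one-vector inference. [cite: Kosovtsov2022, p.8 l.8–13] -/
theorem A_transpose : A.transpose = A := by
  ext i j; fin_cases i <;> fin_cases j <;> rfl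

/-- `⟪Ae₁, e₁⟫ = −1 ≤ 0`: «dissipative at the one vector `e₁`» (the analogue of the energy identity
(21) at the single element `u`). [cite: Kosovtsov2022, (21) p.8] -/
theorem inner_e1_nonpos : dotProduct (A.mulVec ![1, 0]) ![1, 0] ≤ 0 := by
  simp [A, Matrix.mulVec, dotProduct, Fin.sum_univ_two]

/-- `⟪Ae₂, e₂⟫ = 1 > 0`: `A` is NOT dissipative (Lumer–Phillips needs `⟪Aw, w⟫ ≤ 0` for all `w`).
[cite: EngelNagel2006, Thm II.3.15] -/
theorem inner_e2_pos : 0 < dotProduct (A.mulVec ![0, 1]) ![0, 1] := by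
  simp [A, Matrix.mulVec, dotProduct, Fin.sum_univ_two]

/-- The orbit `w(t) = (0, eᵗ) = e^{tA} e₂`. [folklore] -/
def orbit (t : ℝ) : Fin 2 → ℝ := ![0, exp t]

/-- `w` solves `ẇ = A w` componentwise. [cite: EngelNagel2006, Thm I.2.12] -/
theorem orbit_hasDerivAt (t : ℝ) (i : Fin 2) :
    HasDerivAt (fun s => orbit s i) ((A.mulVec (orbit t)) i) t := by
  fin_cases i
  · simp [orbit, A, Matrix.mulVec, dotProduct, Fin.sum_univ_two, hasDerivAt_const]
  · simpa [orbit, A, Matrix.mulVec, dotProduct, Fin.sum_univ_two] using Real.hasDerivAt_exp t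

/-- **No contraction**: the second component of the orbit is `eᵗ > 1 = ‖e₂‖_∞` for `t > 0` — the
semigroup generated by `A` expands, although `⟪Ae₁, e₁⟫ ≤ 0` and `A* = A`. [cite: EngelNagel2006, Thm II.3.15] -/
theorem orbit_grows {t : ℝ} (ht : 0 < t) : 1 < orbit t 1 := by
  simpa [orbit] using Real.one_lt_exp_iff.2 ht  -- `exp t > 1`

end KoopmanLieSeriesFiniteRadius.OneVector

open KoopmanLieSeriesFiniteRadius

/-- **Barrier (method-level lemma): the exponential series of a Koopman / Lie-series generator has
finite radius — it is the time-Taylor series of the nonlinear flow — and for every `t > 0` it diverges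
somewhere; inside the radius it sums to the flow, whose singularity sits exactly at the radius.**
Instance: `ż = z²`, `A = z² d/dz`, observable `id`: `Σₖ tᵏ(Aᵏ id)(z)/k! = Σ z(tz)ᵏ`.

BARRIER (structured block, D-0021):
technique_class: koopman-linearisation lie-series exact-linear-representation carleman-embedding functional-derivative-operator operator-semigroup-reencoding lumer-phillips-from-energy-identity exponential-series-of-unbounded-generator
blocks: arguments for NavierStokesRegularity (and for «any nonlinear PDE», Euler included) that (a) re-encode `∂ₜu = F(u)` as the LINEAR evolution `Ġ = A G`, `A = ∫ F(u) δ/δu` on functionals of `u` [cite: Kosovtsov2022, (8) p.3; (17)–(19) p.7], (b) assert `A` «continuous and therefore bounded and closable» [cite: Kosovtsov2022, §2 p.4 l.1–2; §3 p.7 l.9–11] and `T(t) = e^{tA} = Σ tⁿAⁿ/n!` «converges for every t ≥ 0» [cite: Kosovtsov2022, p.5; p.8–9], (c) infer «A (and A*) dissipative» from the energy identity at the one field `u` [cite: Kosovtsov2022, (21) and l.7–13 p.8] and conclude generation of a contraction semigroup and a unique global classical solution (Prop. 1–2 p.8–9); instance under adjudication: C33 `Kosovtsov2022` (typed skeleton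 `Literature.Claims.NS.Kosovtsov2022`; the sentences (b), (c) are its `Step_2`/`Step_3` and `Step_5`).
because: (1) `A` is a first-order derivation; by the chain rule `Σ tᵏ(AᵏG)/k!` is the Taylor series in `t` of `G ∘ Φ_t` [cite: HairerWannerLubich2002, §III.5.1 eq. (5.7)–(5.8)], i.e. Gröbner's Lie series, convergent for small `|t|` only [cite: Grobner1967LieReihen, Kap. I §2–§3] — kernel: `lieIter_sq_id`, `hasSum_lieSeries` (sum `= z/(1−tz)` for `|tz| < 1`), `not_summable_lieSeries` (divergent for `|tz| ≥ 1`), `exists_not_summable_lieSeries` (every `t > 0` fails at `z = 1/t`), `flow_hasDerivAt` + `flow_unbounded` (radius = blow-up time); for generators containing `Δ` even the linear part has finite time-Taylor radius at Gaussian data (`TimeTaylorFiniteRadius`, `not_exists_entire_timeSeries`); the power-series formula defines `e^{tA}` only for bounded `A` [cite: EngelNagel2006, Thm I.2.12; §II.3 eq. (3.1) Comment]; (2) dissipativity quantifies over `D(A)` [cite: EngelNagel2006, Thm II.3.15] — kernel `OneVector.inner_e1_nonpos`, `OneVector.A_transpose`, `OneVector.inner_e2_pos`, `OneVector.orbit_grows`: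 a symmetric `A` with `⟪Au,u⟫ ≤ 0` at one `u` generating an expanding group.
evasions_known: (a) the Koopman semigroup `G ↦ G ∘ Φ_t` IS a contraction (even unitary) semigroup on `L²(μ)` for a COMPLETE measure-preserving flow — but completeness (global existence) of the flow is the input, not the output, and the semigroup is then defined by composition, not by the exponential series; (b) honest Lie-series numerics (Gröbner; Hairer–Lubich–Wanner Ch. III) use the series LOCALLY in `t` with step-size control — a restatement of local well-posedness for analytic data (Cauchy–Kovalevskaya scale), silent about continuation; (c) Carleman/Koopman truncations with error bounds on finite horizons are legitimate and make no global claim.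
scope_caveats: (i) the kernel witnesses are the scalar ODE `ż = z²` with the observable `id` and a `2 × 2` matrix — they refute the universal assertions («for any predetermined F», «converges for every t ≥ 0», «⟨Au,u⟩ ≤ 0 hence dissipative») at their simplest instances, nothing more; (ii) the PDE-level unboundedness over the paper's own space `L²_u` (test observables `∂ᵐu`) is the refuter's step-level theorem for C33, not restated here; (iii) says nothing about NS blow-up or regularity.
status: established (proved here; Mathlib geometric series / one-variable calculus)
[cite: Grobner1967LieReihen, Kap. I §2–§3] [cite: HairerWannerLubich2002, §III.5.1 eq. (5.7)–(5.8), Lemma 5.1] -/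
def KoopmanLieSeriesFiniteRadius : Prop :=
  (∀ t : ℝ, 0 < t → ∃ z : ℝ, ¬ Summable (fun k : ℕ => t ^ k * lieIter sq k id z / k.factorial)) ∧
  (∀ t z : ℝ, |t * z| < 1 →
    HasSum (fun k : ℕ => t ^ k * lieIter sq k id z / k.factorial) (z / (1 - t * z))) ∧
  (∀ t z : ℝ, z ≠ 0 → 1 ≤ |t * z| →
    ¬ Summable (fun k : ℕ => t ^ k * lieIter sq k id z / k.factorial)) ∧
  (∃ A : Matrix (Fin 2) (Fin 2) ℝ, A.transpose = A ∧ dotProduct (A.mulVec ![1, 0]) ![1, 0] ≤ 0 ∧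
    0 < dotProduct (A.mulVec ![0, 1]) ![0, 1])

/-- Discharge of the barrier statement. [cite: Grobner1967LieReihen, Kap. I §2–§3] -/
theorem koopmanLieSeriesFiniteRadius_holds : KoopmanLieSeriesFiniteRadius :=
  ⟨fun _ ht => exists_not_summable_lieSeries ht, fun _ _ h => hasSum_lieSeries h,
    fun _ _ hz h => not_summable_lieSeries hz h,
    ⟨OneVector.A, OneVector.A_transpose, OneVector.inner_e1_nonpos, OneVector.inner_e2_pos⟩⟩

end Literature.Barriers.NavierStokesRegularity

end

-- WHAT THIS IS NOT: not a claim about NS regularity or blow-up; not a claim about any author beyond the typed locator.
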